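import Literature.Analysis.FluidPDE.ChaeGeneralizedSelfSimilar
import Literature.Analysis.FluidPDE.ChaeAsymptoticallySelfSimilarWeakLimit
import Literature.Analysis.FluidPDE.ChaeAsymptoticallySelfSimilarLimit
import Literature.Analysis.FluidPDE.SteadyNSVeryWeakLpLiouville
import Literature.Analysis.FluidPDE.TaoQuantitativeReduction
import Literature.Analysis.FluidPDE.NSSliceTimePairing
import Literature.Analysis.OperatorTheory.LpDilationContinuity
import HarnessLib

/-!
# Chae 2010, Thm 1.4: the `L^p` profile of a Type-II asymptotically self-similar blow-up is a
# very weak STEADY Navier–Stokes solution; hence Theorem 1.4 holds for `3 < p ≤ 9/2`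

Analysis/FluidPDE proofs file (theorems only: no definitions, no named facts), companion of
`ChaeGeneralizedSelfSimilar.lean` (the named fact `chae2010_typeII_asymptoticallySelfSimilar` —
D. Chae, J. Funct. Anal. 258 (2010) 2865–2883, **Thm. 1.4** = arXiv:0711.1113, §3, **Thm. 3.1**)
and of `SteadyNSVeryWeakLpLiouville.lean` (the last two printed steps of its proof at the very
weak level, `veryWeak_steadyNS_ae_eq_zero_of_weakGradL2Sq_lt_top`, `3 < p ≤ 9/2`).

**What is printed** (arXiv:0711.1113, §3, proof of Thm. 3.1, p. 8 of the held text): "The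
hypothesis (3.1) is now translated as `lim_{s→∞} ‖V(·,s) − V̄‖_{L^p} = 0`. Following exactly same
argument as in the proof of Theorem 1.3, we can deduce that `V̄` is a stationary solution of the
Navier–Stokes equations, namely there exists `P̄` such that `(V̄·∇)V̄ = ΔV̄ − ∇P̄`, `div V̄ = 0`."
— and the argument of Theorem 1.3 (ibid. §1, p. 5): test on the unit time windows `[n, n+1]`
with `ξ(s − n)φ(y)`, `∫ξ ≠ 0`, `φ` divergence free, "passing to the limit `n → ∞` … using the
facts `∫₀¹ ξ_s(s)ds = 0`, `∫₀¹ ξ(s)ds ≠ 0`, `V(·, s+n) → V̄` …, and finally `g(s+n) → 0`".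

**This file proves that step** in the tree's RESCALING vocabulary (the road of the Leray-scaling
companion `ChaeAsymptoticallySelfSimilarWeakLimit.lean`) instead of similarity variables: the
unit windows of similarity time become the physical windows `(t₀ − λ(t₀)², t₀)`,
`λ(t₀) = (T − t₀)^{γ/2}`, seen through the exact Navier–Stokes rescalings
`w_{t₀}(s, y) = λ(t₀) v(t₀ + λ(t₀)² s, λ(t₀) y)`, `−1 < s < 0` — classical solutions, no modulation
term; the price is that the slice `w_{t₀}(s)` is the DILATE `D_μ(λ(t) v(λ(t)·, t))`,
`t = t₀ + λ(t₀)²s`, `μ = λ(t₀)/λ(t) ∈ [(1 + (T−t₀)^{γ−1})^{−γ/2}, 1]`, of the field the hypothesis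
controls, and `μ → 1` uniformly in `s` exactly because `γ > 1` (`λ(t₀)² = (T−t₀)^γ ≪ T − t₀`) — so
Chae's "`g(s+n) → 0`" is replaced by the strong continuity of dilations on `L^p`.

* `tendsto_eLpNorm_comp_smul_sub_self`, `tendsto_eLpNorm_nsRescaleData_sub_self` — strong
  continuity of `V ↦ V(a·)` and `V ↦ aV(a·)` at `a = 1` in `L^p`, `1 ≤ p < ∞` (Stein–Weiss I §1);
* `IsClassicalNSSolutionOn.nsRescale_window`, `nsRescale_slice_eq_nsRescaleData`,
  `eLpNorm_nsRescale_slice_sub_le` — the rescalings are classical on `(−1, 0)`, the slice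
  identity, and `‖w_{t₀}(s) − V̄‖_p ≤ μ^{1−3/p}·chaeTypeIIDeviation(t) + ‖D_μV̄ − V̄‖_p`;
* `tendsto_iSup_eLpNorm_typeIIRescale_sub` — **`sup_{−1<s<0} ‖w_{t₀}(s) − V̄‖_{L^p} → 0` as
  `t₀ ↑ T`**; hence (`integral_veryWeak_eq_zero_of_tendsto`, `isWeaklyDivFree_of_tendsto_eLpNorm_sub`)
  `typeII_profile_integral_veryWeak_const_eq_zero`, `typeII_profile_isWeaklyDivFree`: the
  constant field `(s, y) ↦ V̄(y)` is very weak on the slab `(−1,0) × ℝ³`, `V̄` weakly div-free;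
* `steady_veryWeak_of_const_slab` — Chae's `ξ(s)φ(y)` test: constant + very weak on the slab ⇒
  very weak STEADY;
* **`typeII_profile_veryWeak_steadyNS`** (`p ≥ 2`) — `V̄` is weakly divergence free and
  `∫ (⟪V̄, (V̄·∇)φ⟫ + ⟪V̄, Δφ⟫) = 0` for every divergence-free `φ ∈ C_c^∞(ℝ³; ℝ³)`;
  `typeII_profile_ae_eq_steadyClassicalNS` (`3 < p`) — `V̄` is a.e. a smooth steady velocity;
* **`chae2010_typeII_asymptoticallySelfSimilar_of_le_nineHalves`** — the statement of the named
  fact with the two extra binders `3 < p`, `p ≤ 9/2`: a THEOREM.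

The named fact itself (all `p ≥ 3`) is NOT discharged: for `p > 9/2` the printed step
`∫|∇V̄|² = 0` is the open Liouville problem for D-solutions (`SteadyDSolutionLiouvilleProblem`),
and `p = 3` is below the Kato representative's range. Nothing here asserts that a Type-II
asymptotically self-similar blow-up exists.

## References

* D. Chae, J. Funct. Anal. 258 (2010) 2865–2883, doi:10.1016/j.jfa.2010.02.006 = arXiv:0711.1113:
  §3, Thm. 3.1 and its proof (p. 8 of the held arXiv text); §1, proof of Thm. 1.3 (p. 5: the
  `ξ(s−n)φ(y)` test). [Chae2010]
* D. Chae, Math. Ann. 338 (2007) 435–449 = arXiv:math/0604234, proof of Thm. 1.5. [Chae2007]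
* E. M. Stein, G. Weiss, *Introduction to Fourier Analysis on Euclidean Spaces* (1971), Ch. I §1.
  [SteinWeiss1971]
* G. P. Galdi, *Steady-State Problems*, 2nd ed. (2011), Thm. X.9.5. [Galdi2011]
-/

noncomputable section

open _root_.MeasureTheory Set Function Filter Metric TopologicalSpace
open scoped NNReal ENNReal _root_.Topology RealInnerProductSpace Laplacian

namespace Literature.Analysis.FluidPDE

/-! ### Strong continuity of dilations at the identity (`eLpNorm` form) -/

section Dilation

variable {E : Type*} [NormedAddCommGroup E] [InnerProductSpace ℝ E] [FiniteDimensional ℝ E]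
  [MeasurableSpace E] [BorelSpace E]
variable {F : Type*} [NormedAddCommGroup F] [NormedSpace ℝ F]

omit [FiniteDimensional ℝ E] [MeasurableSpace E] [BorelSpace E] in
/-- The Jacobian factor `|(a^d)⁻¹|^{1/p}` of the `L^p` scaling identity `‖g(a·)‖_p =
|a^d|^{−1/p}‖g‖_p` is at most `2` for `a` near `1` (`1 ≤ p < ∞`). [cite: SteinWeiss1971, Ch. I §1] -/
theorem eventually_dilationFactor_le_two {p : ℝ≥0∞} (hp1 : 1 ≤ p) (hp : p ≠ ∞) :
    ∀ᶠ a : ℝ in 𝓝 1, a ≠ 0 ∧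
      ENNReal.ofReal |(a ^ Module.finrank ℝ E)⁻¹| ^ (1 / p).toReal ≤ 2 := by
  have hcont : Tendsto (fun a : ℝ => a ^ Module.finrank ℝ E) (𝓝 1) (𝓝 1) := by
    have := (continuous_pow (M := ℝ) (Module.finrank ℝ E)).tendsto 1
    simpa using this
  have hhalf : ∀ᶠ a : ℝ in 𝓝 1, (1 / 2 : ℝ) < a ^ Module.finrank ℝ E :=
    hcont.eventually (lt_mem_nhds (by norm_num))
  filter_upwards [hhalf, eventually_ne_nhds (one_ne_zero (α := ℝ))] with a ha ha0
  refine ⟨ha0, ?_⟩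
  have hpos : 0 < a ^ Module.finrank ℝ E := lt_trans (by norm_num) ha
  have h2 : |(a ^ Module.finrank ℝ E)⁻¹| ≤ 2 := by
    rw [abs_of_pos (inv_pos.2 hpos), inv_le_comm₀ hpos (by norm_num : (0 : ℝ) < 2)]
    linarith
  have hr0 : 0 ≤ (1 / p).toReal := ENNReal.toReal_nonneg
  have hr1 : (1 / p).toReal ≤ 1 := by
    rw [one_div, ENNReal.toReal_inv]
    have h1 : 1 ≤ p.toReal := by
      have := ENNReal.toReal_mono hp hp1
      simpa using this
    exact inv_le_one_of_one_le₀ h1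
  have htwo : ENNReal.ofReal (2 : ℝ) = 2 := by norm_num
  calc ENNReal.ofReal |(a ^ Module.finrank ℝ E)⁻¹| ^ (1 / p).toReal
      ≤ ENNReal.ofReal 2 ^ (1 / p).toReal := ENNReal.rpow_le_rpow (ENNReal.ofReal_le_ofReal h2) hr0
    _ ≤ ENNReal.ofReal 2 ^ (1 : ℝ) :=
        ENNReal.rpow_le_rpow_of_exponent_le (by rw [htwo]; norm_num) hr1
    _ = 2 := by rw [htwo, ENNReal.rpow_one]

/-- **Strong continuity of dilations at the identity, `eLpNorm` form**: for `f ∈ L^p`,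
`1 ≤ p < ∞`, `‖f(a·) − f‖_{L^p} → 0` as `a → 1` (density of continuous compactly supported `g`,
for which `g(a·) → g` uniformly with supports in a fixed ball —
`OperatorTheory.tendsto_eLpNorm_comp_smul_sub` — and the locally bounded Jacobian factor of the
`L^p` scaling identity). [cite: SteinWeiss1971, Ch. I §1] -/
theorem tendsto_eLpNorm_comp_smul_sub_self {p : ℝ≥0∞} (hp1 : 1 ≤ p) (hp : p ≠ ∞) {f : E → F}
    (hf : MemLp f p volume) :
    Tendsto (fun a : ℝ => eLpNorm (fun x => f (a • x) - f x) p volume) (𝓝 1) (𝓝 0) := by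
  rw [ENNReal.tendsto_nhds_zero]
  intro ε hε
  rcases eq_or_ne ε ∞ with hεtop | hεtop
  · exact Eventually.of_forall fun _ => hεtop ▸ le_top
  -- approximate `f` by a continuous compactly supported `g` within `ε / 4`
  have hε4 : ε / 4 ≠ 0 := (ENNReal.div_pos hε.ne' (by norm_num)).ne'
  obtain ⟨g, hgsupp, hgf, hgc, hgp⟩ := hf.exists_hasCompactSupport_eLpNorm_sub_le hp hε4
  have hgt : Tendsto (fun a : ℝ => eLpNorm (fun x => g (a • x) - g x) p volume) (𝓝 1) (𝓝 0) := by
    simpa only [one_smul] using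
      OperatorTheory.tendsto_eLpNorm_comp_smul_sub hgc hgsupp (one_ne_zero (α := ℝ)) p
  have hgev : ∀ᶠ a : ℝ in 𝓝 1, eLpNorm (fun x => g (a • x) - g x) p volume ≤ ε / 4 :=
    ENNReal.tendsto_nhds_zero.1 hgt _ (pos_iff_ne_zero.2 hε4)
  filter_upwards [hgev, eventually_dilationFactor_le_two (E := E) hp1 hp] with a hga hJ
  obtain ⟨ha0, hJa⟩ := hJ
  have hfm : AEStronglyMeasurable f volume := hf.1
  have hgm : AEStronglyMeasurable g volume := hgc.aestronglyMeasurable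
  have hqmp := OperatorTheory.quasiMeasurePreserving_smul' (V := E) ha0
  have hfam : AEStronglyMeasurable (fun x => f (a • x)) volume :=
    hfm.comp_quasiMeasurePreserving hqmp
  have hgam : AEStronglyMeasurable (fun x => g (a • x)) volume :=
    hgm.comp_quasiMeasurePreserving hqmp
  -- the three pieces
  have h1 : eLpNorm (fun x => f (a • x) - g (a • x)) p volume ≤ 2 * (ε / 4) := by
    have e := OperatorTheory.eLpNorm_comp_smul (g := f - g) (hfm.sub hgm) ha0 hp
    have : (fun x => f (a • x) - g (a • x)) = fun x => (f - g) (a • x) := rfl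
    rw [this, e]
    exact mul_le_mul' hJa hgf
  have h3 : eLpNorm (g - f) p volume ≤ ε / 4 := by
    rw [eLpNorm_sub_comm]; exact hgf
  have hdecomp : (fun x => f (a • x) - f x) =
      (fun x => f (a • x) - g (a • x)) + ((fun x => g (a • x) - g x) + (g - f)) := by
    funext x
    simp only [Pi.add_apply, Pi.sub_apply]
    abel
  calc eLpNorm (fun x => f (a • x) - f x) p volume
      ≤ eLpNorm (fun x => f (a • x) - g (a • x)) p volume +
          eLpNorm ((fun x => g (a • x) - g x) + (g - f)) p volume := by
        rw [hdecomp]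
        exact eLpNorm_add_le (hfam.sub hgam) ((hgam.sub hgm).add (hgm.sub hfm)) hp1
    _ ≤ eLpNorm (fun x => f (a • x) - g (a • x)) p volume +
          (eLpNorm (fun x => g (a • x) - g x) p volume + eLpNorm (g - f) p volume) := by
        gcongr
        exact eLpNorm_add_le (hgam.sub hgm) (hgm.sub hfm) hp1
    _ ≤ 2 * (ε / 4) + (ε / 4 + ε / 4) := by gcongr
    _ = 4 * (ε / 4) := by ring
    _ = ε := ENNReal.mul_div_cancel (by norm_num) (by norm_num)

/-- **Strong continuity of the Navier–Stokes dilations at the identity**: for `f ∈ L^p`,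
`1 ≤ p < ∞`, `‖a f(a·) − f‖_{L^p} → 0` as `a → 1` (`a f(a·) − f = a(f(a·) − f) + (a − 1)f`).
[cite: SteinWeiss1971, Ch. I §1] -/
theorem tendsto_eLpNorm_nsRescaleData_sub_self {p : ℝ≥0∞} (hp1 : 1 ≤ p) (hp : p ≠ ∞)
    {f : E → F} (hf : MemLp f p volume) :
    Tendsto (fun a : ℝ => eLpNorm (nsRescaleData a f - f) p volume) (𝓝 1) (𝓝 0) := by
  have hfm : AEStronglyMeasurable f volume := hf.1
  -- the bound, for `a` near `1`
  have hbound : ∀ᶠ a : ℝ in 𝓝 1, eLpNorm (nsRescaleData a f - f) p volume ≤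
      2 * eLpNorm (fun x => f (a • x) - f x) p volume + ‖a - 1‖ₑ * eLpNorm f p volume := by
    filter_upwards [eventually_ne_nhds (one_ne_zero (α := ℝ)),
      Ioo_mem_nhds (show (0 : ℝ) < 1 by norm_num) (show (1 : ℝ) < 2 by norm_num)] with a ha0 ha
    have hqmp := OperatorTheory.quasiMeasurePreserving_smul' (V := E) ha0
    have hfam : AEStronglyMeasurable (fun x => f (a • x)) volume :=
      hfm.comp_quasiMeasurePreserving hqmp
    have hdec : nsRescaleData a f - f = a • (fun x => f (a • x) - f x) + (a - 1) • f := by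
      funext x
      simp only [Pi.sub_apply, Pi.add_apply, Pi.smul_apply, nsRescaleData_apply, smul_sub, sub_smul,
        one_smul]
      abel
    have ha2 : ‖a‖ₑ ≤ 2 := by
      rw [Real.enorm_eq_ofReal_abs, abs_of_pos ha.1]
      have : ENNReal.ofReal a ≤ ENNReal.ofReal 2 := ENNReal.ofReal_le_ofReal ha.2.le
      simpa using this
    rw [hdec]
    calc eLpNorm (a • (fun x => f (a • x) - f x) + (a - 1) • f) p volume
        ≤ eLpNorm (a • (fun x => f (a • x) - f x)) p volume + eLpNorm ((a - 1) • f) p volume :=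
          eLpNorm_add_le ((hfam.sub hfm).const_smul a) (hfm.const_smul _) hp1
      _ = ‖a‖ₑ * eLpNorm (fun x => f (a • x) - f x) p volume + ‖a - 1‖ₑ * eLpNorm f p volume := by
          rw [eLpNorm_const_smul, eLpNorm_const_smul]
      _ ≤ 2 * eLpNorm (fun x => f (a • x) - f x) p volume + ‖a - 1‖ₑ * eLpNorm f p volume := by
          gcongr
  -- the bound tends to `0`
  have hA := tendsto_eLpNorm_comp_smul_sub_self hp1 hp hf
  have hA2 : Tendsto (fun a : ℝ => 2 * eLpNorm (fun x => f (a • x) - f x) p volume) (𝓝 1)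
      (𝓝 0) := by
    simpa using ENNReal.Tendsto.const_mul (a := 2) hA (Or.inr ENNReal.ofNat_ne_top)
  have hB0 : Tendsto (fun a : ℝ => ‖a - 1‖ₑ) (𝓝 1) (𝓝 0) := by
    have hc : Continuous fun a : ℝ => ‖a - 1‖ₑ := (continuous_id.sub continuous_const).enorm
    simpa using hc.tendsto (1 : ℝ)
  have hB : Tendsto (fun a : ℝ => ‖a - 1‖ₑ * eLpNorm f p volume) (𝓝 1) (𝓝 0) := by
    simpa using ENNReal.Tendsto.mul_const hB0 (Or.inr hf.2.ne)
  have hsum : Tendsto (fun a : ℝ => 2 * eLpNorm (fun x => f (a • x) - f x) p volume +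
      ‖a - 1‖ₑ * eLpNorm f p volume) (𝓝 1) (𝓝 0) := by
    simpa using hA2.add hB
  exact tendsto_of_tendsto_of_tendsto_of_le_of_le' tendsto_const_nhds hsum
    (Eventually.of_forall fun _ => bot_le) hbound

end Dilation

/-! ### Elementary real-analysis bookkeeping for the Type-II windows -/

section Windows

/-- `(d^{γ/2})² = d^γ` for `d ≥ 0`. [folklore] -/
private theorem rpow_half_sq {d γ : ℝ} (hd : 0 ≤ d) : (d ^ (γ / 2)) ^ 2 = d ^ γ := by
  rw [← Real.rpow_natCast, ← Real.rpow_mul hd]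
  congr 1
  push_cast
  ring

/-- For `½ ≤ μ ≤ 1` and an exponent `e ≥ −2`, `μ^e ≤ 4`. [folklore] -/
private theorem rpow_le_four_of_half_le {μ e : ℝ} (hμ : 1 / 2 ≤ μ) (hμ1 : μ ≤ 1) (he : -2 ≤ e) :
    μ ^ e ≤ 4 := by
  have hμ0 : 0 < μ := lt_of_lt_of_le (by norm_num) hμ
  rcases le_or_gt 0 e with he0 | he0
  · exact (Real.rpow_le_one hμ0.le hμ1 he0).trans (by norm_num)
  · calc μ ^ e ≤ (1 / 2 : ℝ) ^ e := Real.rpow_le_rpow_of_nonpos (by norm_num) hμ he0.le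
      _ = (2 : ℝ) ^ (-e) := by
          rw [one_div, Real.inv_rpow (by norm_num : (0 : ℝ) ≤ 2), Real.rpow_neg (by norm_num)]
      _ ≤ (2 : ℝ) ^ (2 : ℝ) := Real.rpow_le_rpow_of_exponent_le (by norm_num) (by linarith)
      _ = 4 := by norm_num

/-- `T − t₀ → 0` as `t₀ ↑ T`. [folklore] -/
private theorem tendsto_sub_nhdsLT (T : ℝ) : Tendsto (fun t₀ : ℝ => T - t₀) (𝓝[<] T) (𝓝 0) :=
  tendsto_nhdsWithin_of_tendsto_nhds ((continuous_const.sub continuous_id).tendsto' T 0 (by simp))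

/-- `(T − t₀)^q → 0` as `t₀ ↑ T` for `q > 0`. [folklore] -/
private theorem tendsto_rpow_sub_nhdsLT (T : ℝ) {q : ℝ} (hq : 0 < q) :
    Tendsto (fun t₀ : ℝ => (T - t₀) ^ q) (𝓝[<] T) (𝓝 0) := by
  have h := ((Real.continuousAt_rpow_const 0 q (Or.inr hq.le)).tendsto).comp (tendsto_sub_nhdsLT T)
  rwa [Function.comp_def, Real.zero_rpow hq.ne'] at h

/-- **The Type-II windows fit inside `(0, T)` near the blow-up time**: as `t₀ ↑ T`, eventually
`λ(t₀) = (T − t₀)^{γ/2} > 0`, `λ(t₀)² ≤ t₀` and `t₀ < T` (`γ > 0`, `T > 0`: `λ(t₀)² = (T−t₀)^γ → 0`).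
[cite: Chae2010, §3 proof of Thm. 3.1 (the similarity time `s → ∞`)] -/
theorem eventually_nhdsLT_typeII_window {T γ : ℝ} (hT : 0 < T) (hγ : 0 < γ) :
    ∀ᶠ t₀ in 𝓝[<] T, 0 < (T - t₀) ^ (γ / 2) ∧ ((T - t₀) ^ (γ / 2)) ^ 2 ≤ t₀ ∧ t₀ < T := by
  have hsum : Tendsto (fun t₀ : ℝ => (T - t₀) ^ γ + (T - t₀)) (𝓝[<] T) (𝓝 0) := by
    simpa using (tendsto_rpow_sub_nhdsLT T hγ).add (tendsto_sub_nhdsLT T)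
  have hlt : ∀ᶠ t₀ in 𝓝[<] T, (T - t₀) ^ γ + (T - t₀) < T := hsum.eventually (gt_mem_nhds hT)
  have hltT : ∀ᶠ t₀ in 𝓝[<] T, t₀ < T := eventually_nhdsWithin_of_forall fun t ht => ht
  filter_upwards [hlt, hltT] with t₀ h1 h2
  have hd0 : 0 < T - t₀ := sub_pos.2 h2
  refine ⟨Real.rpow_pos_of_pos hd0 _, ?_, h2⟩
  rw [rpow_half_sq hd0.le]
  linarith

/-- The lower bound of the dilation parameter tends to `1`: `(1 + d^{γ−1})^{−γ/2} → 1` as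
`d = T − t₀ ↓ 0` (`γ > 1`). [cite: Chae2010, §3 proof of Thm. 3.1 (the modulation coefficient `g(s+n) → 0`)] -/
theorem tendsto_dilationLowerBound {T γ : ℝ} (hγ : 1 < γ) :
    Tendsto (fun t₀ : ℝ => (1 + (T - t₀) ^ (γ - 1)) ^ (-(γ / 2))) (𝓝[<] T) (𝓝 1) := by
  have hbase : Tendsto (fun t₀ : ℝ => 1 + (T - t₀) ^ (γ - 1)) (𝓝[<] T) (𝓝 1) := by
    simpa using (tendsto_rpow_sub_nhdsLT T (sub_pos.2 hγ)).const_add 1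
  have h := ((Real.continuousAt_rpow_const 1 (-(γ / 2)) (Or.inl one_ne_zero)).tendsto).comp hbase
  rwa [Function.comp_def, Real.one_rpow] at h

end Windows

/-! ### The Type-II rescalings about `(t₀, 0)` -/

section Rescalings

variable {T γ : ℝ} {p : ℝ≥0}
  {v : ℝ → EuclideanSpace ℝ (Fin 3) → EuclideanSpace ℝ (Fin 3)}
  {π : ℝ → EuclideanSpace ℝ (Fin 3) → ℝ}
  {V : EuclideanSpace ℝ (Fin 3) → EuclideanSpace ℝ (Fin 3)}

/-- **The rescalings about `(t₀, 0)` are classical solutions on the unit window**: for a classical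
solution `(v, π)` of Navier–Stokes (`ν = 1`, `f = 0`) on `ℝ³ × (0, T)` and `0 < c` with
`c² ≤ t₀ ≤ T`, the field `w(s, y) = c v(t₀ + c²s, c y)` is, with the pressure `c² π(t₀ + c²s, cy)`,
a classical solution on the time interval `(−1, 0)` (the similarity covariance
`IsClassicalNSSolutionOn.nsRescale_translate_zero`, restricted from `{s | t₀ + c²s ∈ (0, T)}`).
[cite: Chae2010, §3 proof of Thm. 3.1 (the self-similar transform (1.17)–(1.19) with `α = ½`)] -/
theorem IsClassicalNSSolutionOn.nsRescale_window (hv : IsClassicalNSSolutionOn (Ioo 0 T) 1 0 v π)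
    {c t₀ : ℝ} (hc : 0 < c) (hct₀ : c ^ 2 ≤ t₀) (ht₀ : t₀ ≤ T) :
    IsClassicalNSSolutionOn (Ioo (-1) 0) 1 0 (FluidPDE.nsRescale c fun τ x => v (t₀ + τ) x)
      (c ^ 2 • stPull (c ^ 2) c t₀ 0 π) := by
  have key := hv.nsRescale_translate_zero hc t₀ 0
  have hu : (c • stPull (c ^ 2) c t₀ 0 v) = FluidPDE.nsRescale c fun τ x => v (t₀ + τ) x := by
    funext s y
    simp [stPull_apply, nsRescale_apply]
  rw [hu] at key
  refine key.mono (fun s hs => ?_) (uniqueDiffOn_Ioo (-1) 0)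
  simp only [mem_preimage, mem_Ioo] at hs ⊢
  have hc2 : 0 < c ^ 2 := by positivity
  constructor <;> nlinarith [hs.1, hs.2]

/-- **The slice identity.** For `0 < c` and `t := t₀ + c²s < T`, the slice at `s` of the
rescaling `w(s, y) = c v(t₀ + c²s, cy)` is the Navier–Stokes dilate by `μ = c/λ(t)` of the
rescaled field `λ(t) v(λ(t)·, t)`, `λ(t) = (T − t)^{γ/2}`, that the hypothesis of Theorem 1.4
controls: `w(s) = D_μ(λ(t)v(λ(t)·, t))`, `D_μ G = μ G(μ·)` (`μλ(t) = c`).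
[cite: Chae2010, §3 proof of Thm. 3.1 (the translated hypothesis `‖V(·,s) − V̄‖_{L^p} → 0`)] -/
theorem nsRescale_slice_eq_nsRescaleData {c t₀ s : ℝ} (ht : t₀ + c ^ 2 * s < T) :
    FluidPDE.nsRescale c (fun τ x => v (t₀ + τ) x) s =
      nsRescaleData (c / (T - (t₀ + c ^ 2 * s)) ^ (γ / 2)) fun y =>
        (T - (t₀ + c ^ 2 * s)) ^ (γ / 2) • v (t₀ + c ^ 2 * s) ((T - (t₀ + c ^ 2 * s)) ^ (γ / 2) • y) := by
  have hl : (0 : ℝ) < (T - (t₀ + c ^ 2 * s)) ^ (γ / 2) := Real.rpow_pos_of_pos (sub_pos.2 ht) _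
  have hc' : c / (T - (t₀ + c ^ 2 * s)) ^ (γ / 2) * (T - (t₀ + c ^ 2 * s)) ^ (γ / 2) = c :=
    div_mul_cancel₀ _ hl.ne'
  funext y
  simp only [nsRescale_apply, nsRescaleData_apply, smul_smul, mul_comm _ (c / _), hc']

/-- **The slice estimate**: with `t = t₀ + c²s ∈ (0, T)`, `λ(t) = (T−t)^{γ/2}`, `μ = c/λ(t)`,
`‖w(s) − V̄‖_{L^p} ≤ μ^{1−3/p} · chaeTypeIIDeviation T γ p v V̄ t + ‖D_μ V̄ − V̄‖_{L^p}`
(`w(s) − V̄ = D_μ(G − V̄) + (D_μV̄ − V̄)`, `G = λ(t)v(λ(t)·, t)`; the `L^p` scaling law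
`eLpNorm_nsRescaleData_holds` and `chaeTypeIIDeviation_eq_eLpNorm_rescale`).
[cite: Chae2010, §3 proof of Thm. 3.1] -/
theorem eLpNorm_nsRescale_slice_sub_le (hv : IsClassicalNSSolutionOn (Ioo 0 T) 1 0 v π)
    (hp1 : 1 ≤ p) (hV : MemLp V (p : ℝ≥0∞) volume) {c t₀ s : ℝ} (hc : 0 < c)
    (ht0 : 0 < t₀ + c ^ 2 * s) (htT : t₀ + c ^ 2 * s < T) :
    eLpNorm (fun y => FluidPDE.nsRescale c (fun τ x => v (t₀ + τ) x) s y - V y) (p : ℝ≥0∞) volume ≤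
      ENNReal.ofReal ((c / (T - (t₀ + c ^ 2 * s)) ^ (γ / 2)) ^ (1 - 3 / (p : ℝ))) *
          chaeTypeIIDeviation T γ p v V (t₀ + c ^ 2 * s) +
        eLpNorm (nsRescaleData (c / (T - (t₀ + c ^ 2 * s)) ^ (γ / 2)) V - V) (p : ℝ≥0∞) volume := by
  set t : ℝ := t₀ + c ^ 2 * s with ht
  set lam : ℝ := (T - t) ^ (γ / 2) with hlam
  have hlam0 : 0 < lam := Real.rpow_pos_of_pos (sub_pos.2 htT) _
  set μ : ℝ := c / lam with hμ
  have hμ0 : 0 < μ := div_pos hc hlam0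
  set G : EuclideanSpace ℝ (Fin 3) → EuclideanSpace ℝ (Fin 3) := fun y => lam • v t (lam • y) with hG
  have hp0 : p ≠ 0 := (lt_of_lt_of_le one_pos hp1).ne'
  have hscale : eLpNorm_nsRescaleData (E := EuclideanSpace ℝ (Fin 3)) (F := EuclideanSpace ℝ (Fin 3)) :=
    @eLpNorm_nsRescaleData_holds (EuclideanSpace ℝ (Fin 3)) _ _ (EuclideanSpace ℝ (Fin 3)) _ _
  have hdev : chaeTypeIIDeviation T γ p v V t = eLpNorm (G - V) (p : ℝ≥0∞) volume :=
    chaeTypeIIDeviation_eq_eLpNorm_rescale hscale hp0 v V htT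
  have hslice : FluidPDE.nsRescale c (fun τ x => v (t₀ + τ) x) s = nsRescaleData μ G :=
    nsRescale_slice_eq_nsRescaleData htT
  have hvt : Continuous (v t) := (hv.contDiff_velocity ⟨ht0, htT⟩).continuous
  have hGc : Continuous G := by show Continuous fun y => lam • v t (lam • y); fun_prop
  have hGV : AEStronglyMeasurable (G - V) volume := hGc.aestronglyMeasurable.sub hV.1
  have hqmp := OperatorTheory.quasiMeasurePreserving_smul' (V := EuclideanSpace ℝ (Fin 3)) hμ0.ne'
  have hD1 : AEStronglyMeasurable (nsRescaleData μ (G - V)) volume :=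
    (hGV.comp_quasiMeasurePreserving hqmp).const_smul μ
  have hD2 : AEStronglyMeasurable (nsRescaleData μ V - V) volume :=
    ((hV.1.comp_quasiMeasurePreserving hqmp).const_smul μ).sub hV.1
  have hdec : (fun y => FluidPDE.nsRescale c (fun τ x => v (t₀ + τ) x) s y - V y) =
      nsRescaleData μ (G - V) + (nsRescaleData μ V - V) := by
    rw [hslice]
    funext y
    simp only [Pi.add_apply, Pi.sub_apply, nsRescaleData_apply, smul_sub]
    abel
  rw [hdec]
  calc eLpNorm (nsRescaleData μ (G - V) + (nsRescaleData μ V - V)) (p : ℝ≥0∞) volume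
      ≤ eLpNorm (nsRescaleData μ (G - V)) (p : ℝ≥0∞) volume +
          eLpNorm (nsRescaleData μ V - V) (p : ℝ≥0∞) volume :=
        eLpNorm_add_le hD1 hD2 (by exact_mod_cast hp1)
    _ = ENNReal.ofReal (μ ^ (1 - 3 / (p : ℝ))) * chaeTypeIIDeviation T γ p v V t +
          eLpNorm (nsRescaleData μ V - V) (p : ℝ≥0∞) volume := by
        congr 1
        have key := hscale (μ := (volume : Measure (EuclideanSpace ℝ (Fin 3)))) (G - V) hμ0
          (p := (p : ℝ≥0∞)) (by exact_mod_cast hp0) ENNReal.coe_ne_top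
        rw [finrank_euclideanSpace_fin] at key
        rw [key, hdev]
        norm_num

/-- **Uniform convergence of the Type-II rescalings on the unit window**: for `T > 0`, a
classical solution `(v, π)` of Navier–Stokes (`ν = 1`, `f = 0`) on `ℝ³ × (0, T)`, `γ > 1`,
`p ∈ [1, ∞)`, `V̄ ∈ L^p` and `chaeTypeIIDeviation T γ p v V̄ t → 0` as `t ↑ T` (the hypothesis of
Chae's Thm. 1.4 as typed), the rescalings `w_{t₀}(s, y) = λ(t₀) v(t₀ + λ(t₀)²s, λ(t₀)y)`,
`λ(t₀) = (T − t₀)^{γ/2}`, satisfy `sup_{−1<s<0} ‖w_{t₀}(s) − V̄‖_{L^p(ℝ³)} → 0` as `t₀ ↑ T`: by the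
slice estimate with `t = t₀ + λ(t₀)²s ∈ (t₀ − (T−t₀)^γ, t₀)` (a window shrinking to `T`) and
`μ = λ(t₀)/λ(t) ∈ [(1 + (T−t₀)^{γ−1})^{−γ/2}, 1] → 1` uniformly in `s` since `γ > 1` (Chae's
"`g(s+n) → 0`"), plus the strong continuity of dilations.
[cite: Chae2010, §3 proof of Thm. 3.1 (`V(·, s+n) → V̄` in `L^p`, `g(s+n) → 0`)] -/
theorem tendsto_iSup_eLpNorm_typeIIRescale_sub (hT : 0 < T)
    (hv : IsClassicalNSSolutionOn (Ioo 0 T) 1 0 v π) (hγ : 1 < γ) (hp1 : 1 ≤ p)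
    (hV : MemLp V (p : ℝ≥0∞) volume)
    (hconv : Tendsto (chaeTypeIIDeviation T γ p v V) (𝓝[<] T) (𝓝 0)) :
    Tendsto (fun t₀ : ℝ => ⨆ s ∈ Ioo (-1 : ℝ) 0, eLpNorm
      (fun y => FluidPDE.nsRescale ((T - t₀) ^ (γ / 2)) (fun τ x => v (t₀ + τ) x) s y - V y)
      (p : ℝ≥0∞) volume) (𝓝[<] T) (𝓝 0) := by
  rw [ENNReal.tendsto_nhds_zero]
  intro ε hε
  rcases eq_or_ne ε ∞ with hεtop | hεtop
  · exact Eventually.of_forall fun _ => hεtop ▸ le_top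
  set η : ℝ≥0∞ := ε / 8 with hη
  have hη0 : 0 < η := ENNReal.div_pos hε.ne' (by norm_num)
  have h4η0 : 0 < 4 * η := ENNReal.mul_pos (by norm_num) hη0.ne'
  -- (i) the deviation is `≤ η` on a window `(T − δ₁, T)`
  obtain ⟨δ₁, hδ₁, hdev⟩ : ∃ δ₁ > 0, ∀ t, T - δ₁ < t → t < T →
      chaeTypeIIDeviation T γ p v V t ≤ η := by
    have h := ENNReal.tendsto_nhds_zero.1 hconv _ hη0
    rcases mem_nhdsLT_iff_exists_Ioo_subset.1 h with ⟨l, hl, hsub⟩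
    exact ⟨T - l, sub_pos.2 hl, fun t h1 h2 => hsub ⟨by linarith, h2⟩⟩
  -- (ii) dilation continuity: `‖D_μ V − V‖_p ≤ 4η` for `|μ − 1| < δ₂ ≤ ½`
  obtain ⟨δ₂, hδ₂, hδ₂h, hdil⟩ : ∃ δ₂ > 0, δ₂ ≤ 1 / 2 ∧ ∀ μ : ℝ, dist μ 1 < δ₂ →
      eLpNorm (nsRescaleData μ V - V) (p : ℝ≥0∞) volume ≤ 4 * η := by
    have h := ENNReal.tendsto_nhds_zero.1 (tendsto_eLpNorm_nsRescaleData_sub_self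
      (E := EuclideanSpace ℝ (Fin 3)) (by exact_mod_cast hp1) ENNReal.coe_ne_top hV) _ h4η0
    obtain ⟨δ, hδ, hball⟩ := Metric.eventually_nhds_iff.1 h
    exact ⟨min δ (1 / 2), lt_min hδ (by norm_num), min_le_right _ _,
      fun μ hμ => hball (lt_of_lt_of_le hμ (min_le_left _ _))⟩
  -- (iii) good parameters
  have hγ0 : 0 < γ := zero_lt_one.trans hγ
  have hsum : Tendsto (fun t₀ : ℝ => (T - t₀) ^ γ + (T - t₀)) (𝓝[<] T) (𝓝 0) := by
    simpa using (tendsto_rpow_sub_nhdsLT T hγ0).add (tendsto_sub_nhdsLT T)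
  have hwin : ∀ᶠ t₀ in 𝓝[<] T, (T - t₀) ^ γ + (T - t₀) < δ₁ :=
    hsum.eventually (gt_mem_nhds hδ₁)
  have hlow : ∀ᶠ t₀ in 𝓝[<] T, 1 - δ₂ < (1 + (T - t₀) ^ (γ - 1)) ^ (-(γ / 2)) :=
    (tendsto_dilationLowerBound (T := T) hγ).eventually (lt_mem_nhds (by linarith))
  filter_upwards [eventually_nhdsLT_typeII_window hT hγ0, hwin, hlow] with t₀ hgood hwin hlow
  obtain ⟨hc0, hct₀, ht₀T⟩ := hgood
  refine iSup₂_le fun s hs => ?_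
  -- the window and the time `t`
  set d : ℝ := T - t₀ with hd
  have hd0 : 0 < d := sub_pos.2 ht₀T
  set c : ℝ := d ^ (γ / 2) with hc
  have hc2 : c ^ 2 = d ^ γ := rpow_half_sq hd0.le
  set t : ℝ := t₀ + c ^ 2 * s with ht
  have hdγ0 : 0 < d ^ γ := Real.rpow_pos_of_pos hd0 _
  have ht_lt : t < t₀ := by
    rw [ht, hc2]; nlinarith [hs.2]
  have ht_gt : t₀ - d ^ γ < t := by
    rw [ht, hc2]; nlinarith [hs.1]
  have ht0 : 0 < t := by rw [hc2] at hct₀; linarith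
  have htT : t < T := ht_lt.trans ht₀T
  have htδ : T - δ₁ < t := by linarith
  -- `T − t` between `d` and `d + d^γ`
  have hTt_ge : d ≤ T - t := by rw [hd]; linarith
  have hTt_le : T - t ≤ d + d ^ γ := by rw [hd]; linarith
  have hTt0 : 0 < T - t := hd0.trans_le hTt_ge
  -- the dilation parameter `μ = c / (T − t)^{γ/2} ∈ [(1 + d^{γ−1})^{−γ/2}, 1]`
  set μ : ℝ := c / (T - t) ^ (γ / 2) with hμ
  have hlam0 : 0 < (T - t) ^ (γ / 2) := Real.rpow_pos_of_pos hTt0 _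
  have hμ0 : 0 < μ := div_pos hc0 hlam0
  have hγ2 : 0 ≤ γ / 2 := by linarith
  have hμ_le : μ ≤ 1 := by
    rw [hμ, div_le_one hlam0, hc]
    exact Real.rpow_le_rpow hd0.le hTt_ge hγ2
  have hμ_ge : (1 + d ^ (γ - 1)) ^ (-(γ / 2)) ≤ μ := by
    have hbase : (1 + d ^ (γ - 1))⁻¹ ≤ d / (T - t) := by
      rw [inv_eq_one_div, div_le_div_iff₀ (by positivity) hTt0, one_mul]
      calc T - t ≤ d + d ^ γ := hTt_le
        _ = d * (1 + d ^ (γ - 1)) := by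
            rw [mul_add, mul_one, ← Real.rpow_one_add' hd0.le (by linarith)]
            ring_nf
    calc (1 + d ^ (γ - 1)) ^ (-(γ / 2)) = ((1 + d ^ (γ - 1))⁻¹) ^ (γ / 2) := by
          rw [Real.rpow_neg (by positivity), Real.inv_rpow (by positivity)]
      _ ≤ (d / (T - t)) ^ (γ / 2) := Real.rpow_le_rpow (by positivity) hbase hγ2
      _ = μ := by rw [Real.div_rpow hd0.le hTt0.le, hμ, hc]
  have hμ_dist : dist μ 1 < δ₂ := by
    rw [Real.dist_eq, abs_sub_comm, abs_of_nonneg (by linarith)]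
    linarith
  have hμ_half : 1 / 2 ≤ μ := by
    have : |μ - 1| < 1 / 2 := by
      have h := hμ_dist; rw [Real.dist_eq] at h; exact lt_of_lt_of_le h hδ₂h
    rw [abs_lt] at this
    linarith
  -- the Jacobian factor `μ^{1−3/p} ≤ 4`
  have hp1R : (1 : ℝ) ≤ (p : ℝ) := by exact_mod_cast hp1
  have hJ : ENNReal.ofReal (μ ^ (1 - 3 / (p : ℝ))) ≤ 4 := by
    have he : -2 ≤ 1 - 3 / (p : ℝ) := by
      have : 3 / (p : ℝ) ≤ 3 := by
        rw [div_le_iff₀ (by linarith)]; nlinarith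
      linarith
    have h4 : ENNReal.ofReal (4 : ℝ) = 4 := by norm_num
    exact (ENNReal.ofReal_le_ofReal (rpow_le_four_of_half_le hμ_half hμ_le he)).trans_eq h4
  -- assemble
  calc eLpNorm (fun y => FluidPDE.nsRescale c (fun τ x => v (t₀ + τ) x) s y - V y) (p : ℝ≥0∞) volume
      ≤ ENNReal.ofReal (μ ^ (1 - 3 / (p : ℝ))) * chaeTypeIIDeviation T γ p v V t +
          eLpNorm (nsRescaleData μ V - V) (p : ℝ≥0∞) volume :=
        eLpNorm_nsRescale_slice_sub_le hv hp1 hV hc0 ht0 htT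
    _ ≤ 4 * η + 4 * η := add_le_add (mul_le_mul' hJ (hdev t htδ htT)) (hdil μ hμ_dist)
    _ = 8 * (ε / 8) := by rw [hη]; ring
    _ = ε := ENNReal.mul_div_cancel (by norm_num) (by norm_num)

end Rescalings

/-! ### The weak limit: the constant field `V̄` on the slab `(−1, 0) × ℝ³` -/

section WeakLimit

variable {T γ : ℝ} {p : ℝ≥0}
  {v : ℝ → EuclideanSpace ℝ (Fin 3) → EuclideanSpace ℝ (Fin 3)}
  {π : ℝ → EuclideanSpace ℝ (Fin 3) → ℝ}
  {V : EuclideanSpace ℝ (Fin 3) → EuclideanSpace ℝ (Fin 3)}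

/-- **The constant field `(s, y) ↦ V̄(y)` is a very weak Navier–Stokes solution on the slab
`(−1, 0) × ℝ³`** under the hypothesis of Chae's Thm. 1.4 (`p ≥ 2`): the classical rescalings
`w_{t₀}` satisfy the very weak identity on the slab (`nsRescale_window`,
`IsClassicalNSSolutionOn.integral_veryWeak_eq_zero`) and converge to it in
`L^∞((−1,0); L^p(ℝ³))` (`tendsto_iSup_eLpNorm_typeIIRescale_sub`), so the tree's abstract limit
theorem `integral_veryWeak_eq_zero_of_tendsto` applies ("pass to the limit in the weak
formulation"). [cite: Chae2010, §3 proof of Thm. 3.1 with §1 proof of Thm. 1.3 (p. 5 of the arXiv text)] -/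
theorem typeII_profile_integral_veryWeak_const_eq_zero (hT : 0 < T)
    (hv : IsClassicalNSSolutionOn (Ioo 0 T) 1 0 v π) (hγ : 1 < γ) (hp2 : 2 ≤ p)
    (hV : MemLp V (p : ℝ≥0∞) volume)
    (hconv : Tendsto (chaeTypeIIDeviation T γ p v V) (𝓝[<] T) (𝓝 0))
    {ψ : ℝ → EuclideanSpace ℝ (Fin 3) → EuclideanSpace ℝ (Fin 3)}
    (hψ : IsSpaceTimeTestOn (slab (EuclideanSpace ℝ (Fin 3)) (Ioo (-1) 0) isOpen_Ioo) ψ)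
    (hdivψ : ∀ t, VectorCalculus.IsDivFree (ψ t)) :
    ∫ t in Ioo (-1) 0, ∫ x, (⟪V x, timeDeriv ψ t x⟫ + ⟪V x, convect V (ψ t) x⟫ +
        1 * ⟪V x, Δ (ψ t) x⟫) = 0 := by
  have hp1 : 1 ≤ p := le_trans one_le_two hp2
  have hp2' : (2 : ℝ≥0∞) ≤ (p : ℝ≥0∞) := by exact_mod_cast hp2
  have hgood := eventually_nhdsLT_typeII_window hT (zero_lt_one.trans hγ)
  have key := integral_veryWeak_eq_zero_of_tendsto (l := 𝓝[<] T) (ν := 1) (q := (p : ℝ≥0∞)) hp2'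
    (w := fun t₀ => FluidPDE.nsRescale ((T - t₀) ^ (γ / 2)) fun τ x => v (t₀ + τ) x)
    (U := fun _ => V) ?_ ?_ ?_ ?_ ?_ hψ hdivψ
  · exact key
  · filter_upwards [hgood] with t₀ ht₀
    exact (hv.nsRescale_window ht₀.1 ht₀.2.1 ht₀.2.2.le).smooth_velocity.continuousOn
  · filter_upwards [hgood] with t₀ ht₀
    intro ψ' hψ' hdiv'
    exact (hv.nsRescale_window ht₀.1 ht₀.2.1 ht₀.2.2.le).integral_veryWeak_eq_zero hψ' hdiv'
  · exact fun t _ => hV.1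
  · intro a b _ _ R
    refine ⟨(eLpNorm V (p : ℝ≥0∞) volume).toNNReal, fun t _ => ?_⟩
    rw [ENNReal.coe_toNNReal hV.2.ne]
    exact eLpNorm_mono_measure _ Measure.restrict_le_self
  · intro R
    refine tendsto_of_tendsto_of_tendsto_of_le_of_le tendsto_const_nhds
      (tendsto_iSup_eLpNorm_typeIIRescale_sub hT hv hγ hp1 hV hconv) (fun _ => bot_le)
      fun t₀ => ?_
    exact iSup₂_mono fun s _ => eLpNorm_mono_measure _ Measure.restrict_le_self

/-- **The profile is weakly divergence free** (`p ≥ 1`): the divergence-free classical slices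
`w_{t₀}(−½)` converge to `V̄` in `L^p(ℝ³)` (`isWeaklyDivFree_of_tendsto_eLpNorm_sub`; Chae:
"we can pass `s → ∞` directly in the weak formulation of the second equation").
[cite: Chae2010, §1 proof of Thm. 1.3 (last display, p. 5 of the arXiv text) with §3 proof of Thm. 3.1] -/
theorem typeII_profile_isWeaklyDivFree (hT : 0 < T)
    (hv : IsClassicalNSSolutionOn (Ioo 0 T) 1 0 v π) (hγ : 1 < γ) (hp1 : 1 ≤ p)
    (hV : MemLp V (p : ℝ≥0∞) volume)
    (hconv : Tendsto (chaeTypeIIDeviation T γ p v V) (𝓝[<] T) (𝓝 0)) :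
    IsWeaklyDivFree V := by
  have hgood := eventually_nhdsLT_typeII_window hT (zero_lt_one.trans hγ)
  have hs : (-(1 / 2) : ℝ) ∈ Ioo (-1 : ℝ) 0 := by constructor <;> norm_num
  have hp1' : (1 : ℝ≥0∞) ≤ (p : ℝ≥0∞) := by exact_mod_cast hp1
  refine isWeaklyDivFree_of_tendsto_eLpNorm_sub (l := 𝓝[<] T) hp1'
    (w := fun t₀ => FluidPDE.nsRescale ((T - t₀) ^ (γ / 2)) (fun τ x => v (t₀ + τ) x) (-(1 / 2)))
    ?_ ?_ hV.1 (fun R => lt_of_le_of_lt (eLpNorm_mono_measure _ Measure.restrict_le_self) hV.2) ?_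
  · filter_upwards [hgood] with t₀ ht₀
    exact (hv.nsRescale_window ht₀.1 ht₀.2.1 ht₀.2.2.le).isWeaklyDivFree_slice hs
  · filter_upwards [hgood] with t₀ ht₀
    exact ((hv.nsRescale_window ht₀.1 ht₀.2.1 ht₀.2.2.le).contDiff_velocity hs).continuous
      |>.aestronglyMeasurable
  · intro R
    refine tendsto_of_tendsto_of_tendsto_of_le_of_le tendsto_const_nhds
      (tendsto_iSup_eLpNorm_typeIIRescale_sub hT hv hγ hp1 hV hconv) (fun _ => bot_le)
      fun t₀ => (eLpNorm_mono_measure _ Measure.restrict_le_self).trans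
        (le_iSup₂_of_le (-(1 / 2)) hs le_rfl)

end WeakLimit

/-! ### From the slab to the steady identity: Chae's `ξ(s)φ(y)` test -/

section Steady

variable {p : ℝ≥0} {V : EuclideanSpace ℝ (Fin 3) → EuclideanSpace ℝ (Fin 3)}

/-- Integrability of the steady very weak integrand `⟪V, (V·∇)φ⟫ + ⟪V, Δφ⟫` for `V ∈ L²_{loc}`
and a test field `φ` (`|⟪V, Dφ(V)⟫ + ⟪V, Δφ⟫| ≤ K(‖V‖ + ‖V‖²)` on the support). [folklore] -/
private theorem integrable_steadyVeryWeakIntegrand {φ : EuclideanSpace ℝ (Fin 3) → EuclideanSpace ℝ (Fin 3)}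
    (hφ : FunctionSpaces.IsTestFunctionOn (⊤ : Opens (EuclideanSpace ℝ (Fin 3))) φ)
    (hV : AEStronglyMeasurable V volume)
    (hV2 : ∀ R : ℝ, 0 < R → MemLp V 2 (volume.restrict (ball 0 R))) :
    Integrable (fun x => ⟪V x, convect V φ x⟫ + ⟪V x, Δ φ x⟫) volume := by
  have hφ2 : ContDiff ℝ 2 φ := hφ.contDiff.of_le (by norm_cast)
  have hφ1 : ContDiff ℝ 1 φ := hφ.contDiff.of_le (by norm_cast)
  obtain ⟨R, hR0, hR⟩ : ∃ R, 0 < R ∧ tsupport φ ⊆ ball (0 : EuclideanSpace ℝ (Fin 3)) R :=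
    hφ.hasCompactSupport.isBounded.subset_ball_lt 0 0
  have hDc : Continuous (fderiv ℝ φ) := hφ1.continuous_fderiv one_ne_zero
  have hDcs : HasCompactSupport (fderiv ℝ φ) := hφ.hasCompactSupport.fderiv (𝕜 := ℝ)
  obtain ⟨K₁, hK₁⟩ : ∃ K, ∀ x, ‖fderiv ℝ φ x‖ ≤ K := hDc.bounded_above_of_compact_support hDcs
  have hLc : Continuous (Δ φ) := continuous_laplacian hφ2
  have hLcs : HasCompactSupport (Δ φ) :=
    HasCompactSupport.intro hφ.hasCompactSupport fun x hx => laplacian_eq_zero_of_notMem_tsupport hx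
  obtain ⟨K₂, hK₂⟩ : ∃ K, ∀ x, ‖(Δ φ) x‖ ≤ K := hLc.bounded_above_of_compact_support hLcs
  have hD0 : ∀ x, x ∉ ball (0 : EuclideanSpace ℝ (Fin 3)) R → fderiv ℝ φ x = 0 := fun x hx => by
    have h0 : φ =ᶠ[𝓝 x] fun _ => 0 := notMem_tsupport_iff_eventuallyEq.1 fun h => hx (hR h)
    rw [h0.fderiv_eq, fderiv_fun_const, Pi.zero_apply]
  have hL0 : ∀ x, x ∉ ball (0 : EuclideanSpace ℝ (Fin 3)) R → (Δ φ) x = 0 := fun x hx =>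
    laplacian_eq_zero_of_notMem_tsupport fun h => hx (hR h)
  have happ : Continuous fun q : (EuclideanSpace ℝ (Fin 3) →L[ℝ] EuclideanSpace ℝ (Fin 3)) ×
      EuclideanSpace ℝ (Fin 3) => q.1 q.2 :=
    (isBoundedBilinearMap_apply (𝕜 := ℝ) (E := EuclideanSpace ℝ (Fin 3))
      (F := EuclideanSpace ℝ (Fin 3))).continuous
  -- measurability
  have hm1' : AEStronglyMeasurable (fun w => fderiv ℝ φ w (V w)) volume :=
    happ.comp_aestronglyMeasurable (hDc.aestronglyMeasurable.prodMk hV)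
  have hm1 : AEStronglyMeasurable (fun w => ⟪V w, convect V φ w⟫) volume := by
    simpa only [convect_apply] using hV.inner hm1'
  have hm2 : AEStronglyMeasurable (fun w => ⟪V w, (Δ φ) w⟫) volume := hV.inner hLc.aestronglyMeasurable
  have hK1' : 0 ≤ K₁ := (norm_nonneg _).trans (hK₁ 0)
  have hK2' : 0 ≤ K₂ := (norm_nonneg _).trans (hK₂ 0)
  have hb : ∀ x ∈ ball (0 : EuclideanSpace ℝ (Fin 3)) R,
      ‖⟪V x, convect V φ x⟫ + ⟪V x, Δ φ x⟫‖ ≤ (K₁ + K₂) * (‖V x‖ + ‖V x‖ ^ 2) := by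
    intro x _
    rw [Real.norm_eq_abs, convect_apply]
    have e1 : |⟪V x, fderiv ℝ φ x (V x)⟫| ≤ ‖V x‖ * (K₁ * ‖V x‖) := by
      refine (abs_real_inner_le_norm _ _).trans (mul_le_mul_of_nonneg_left ?_ (norm_nonneg _))
      exact (ContinuousLinearMap.le_opNorm _ _).trans
        (mul_le_mul_of_nonneg_right (hK₁ x) (norm_nonneg _))
    have e2 : |⟪V x, (Δ φ) x⟫| ≤ ‖V x‖ * K₂ :=
      (abs_real_inner_le_norm _ _).trans (mul_le_mul_of_nonneg_left (hK₂ x) (norm_nonneg _))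
    have hsum := (abs_add_le _ _).trans (add_le_add e1 e2)
    nlinarith [norm_nonneg (V x), sq_nonneg ‖V x‖, hsum]
  exact integrable_of_bound_of_memLp_ball (hm1.add hm2)
    (fun x hx => by rw [convect_apply, hD0 x hx, hL0 x hx]; simp) (hV2 R hR0) hb

/-- **From the slab to the steady identity** (Chae's `ξ(s)φ(y)` test, proof of Thm. 1.3 carried
into Thm. 1.4: "using the facts `∫₀¹ ξ_s(s)ds = 0`, `∫₀¹ ξ(s)ds ≠ 0`"): if `V ∈ L^p(ℝ³)`, `p ≥ 2`,
and the constant field `(s, y) ↦ V(y)` satisfies the very weak Navier–Stokes identity on the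
slab `(−1, 0) × ℝ³` for every divergence-free space–time test field, then
`∫ (⟪V, (V·∇)φ⟫ + ⟪V, Δφ⟫) = 0` for every divergence-free `φ ∈ C_c^∞(ℝ³; ℝ³)`: test with
`ξ(s)φ(y)`, `ξ` a smooth bump supported in `[−¾, −¼]`; slice by slice the pairing is
`ξ'(s)∫⟪V, φ⟫ + ξ(s)∫(⟪V, (V·∇)φ⟫ + ⟪V, Δφ⟫)`, and `∫ξ' = 0`, `∫ξ > 0`.
[cite: Chae2010, §1 proof of Thm. 1.3 (p. 5 of the arXiv text), used in §3 proof of Thm. 3.1] -/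
theorem steady_veryWeak_of_const_slab (hp2 : 2 ≤ p) (hV : MemLp V (p : ℝ≥0∞) volume)
    (hslab : ∀ ψ : ℝ → EuclideanSpace ℝ (Fin 3) → EuclideanSpace ℝ (Fin 3),
      IsSpaceTimeTestOn (slab (EuclideanSpace ℝ (Fin 3)) (Ioo (-1) 0) isOpen_Ioo) ψ →
      (∀ t, VectorCalculus.IsDivFree (ψ t)) →
      ∫ t in Ioo (-1) 0, ∫ x, (⟪V x, timeDeriv ψ t x⟫ + ⟪V x, convect V (ψ t) x⟫ +
        1 * ⟪V x, Δ (ψ t) x⟫) = 0)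
    {φ : EuclideanSpace ℝ (Fin 3) → EuclideanSpace ℝ (Fin 3)}
    (hφ : FunctionSpaces.IsTestFunctionOn (⊤ : Opens (EuclideanSpace ℝ (Fin 3))) φ)
    (hdivφ : VectorCalculus.IsDivFree φ) :
    ∫ x, (⟪V x, convect V φ x⟫ + ⟪V x, Δ φ x⟫) = 0 := by
  -- the bump `ξ`, supported in `[−¾, −¼] ⊂ (−1, 0)`
  let ξ : ContDiffBump (-(1 / 2) : ℝ) := ⟨1 / 8, 1 / 4, by norm_num, by norm_num⟩
  have hξsupp : tsupport (ξ : ℝ → ℝ) ⊆ Ioo (-1 : ℝ) 0 := by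
    have hr : ξ.rOut = 1 / 4 := rfl
    rw [ξ.tsupport_eq, Real.closedBall_eq_Icc, hr]
    intro s hs
    simp only [mem_Icc] at hs
    simp only [mem_Ioo]
    constructor <;> linarith [hs.1, hs.2]
  have hξd : Differentiable ℝ (ξ : ℝ → ℝ) := (ξ.contDiff (n := ⊤)).differentiable (by simp)
  -- the product test field
  have hψ : IsSpaceTimeTestOn (slab (EuclideanSpace ℝ (Fin 3)) (Ioo (-1) 0) isOpen_Ioo)
      (fun s y => (ξ : ℝ → ℝ) s • φ y) :=
    isSpaceTimeTestOn_prod_smul isOpen_Ioo isOpen_univ ξ.contDiff ξ.hasCompactSupport hξsupp hφ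
  have hψdiv : ∀ s, VectorCalculus.IsDivFree (fun y => (ξ : ℝ → ℝ) s • φ y) := fun s y => by
    rw [divergence_const_smul_apply ((hφ.contDiff.differentiable (by simp)) y), hdivφ y, mul_zero]
  have key := hslab _ hψ hψdiv
  -- `V ∈ L²_{loc}`
  have hV2 : ∀ R : ℝ, 0 < R → MemLp V 2 (volume.restrict (ball 0 R)) := fun R _ => by
    haveI : IsFiniteMeasure (volume.restrict (ball (0 : EuclideanSpace ℝ (Fin 3)) R)) :=
      isFiniteMeasure_restrict.2 measure_ball_lt_top.ne
    exact (hV.restrict _).mono_exponent (by exact_mod_cast hp2)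
  have hIA : Integrable (fun x => ⟪V x, φ x⟫) volume :=
    integrable_inner_testField_of_memLp_loc hφ hV.1 hV2
  have hIB : Integrable (fun x => ⟪V x, convect V φ x⟫ + ⟪V x, Δ φ x⟫) volume :=
    integrable_steadyVeryWeakIntegrand hφ hV.1 hV2
  set A : ℝ := ∫ x, ⟪V x, φ x⟫ with hA
  set B : ℝ := ∫ x, (⟪V x, convect V φ x⟫ + ⟪V x, Δ φ x⟫) with hB
  -- slice by slice
  have hφ2 : ContDiff ℝ 2 φ := hφ.contDiff.of_le (by norm_cast)
  have hpt : ∀ s x, (⟪V x, timeDeriv (fun s y => (ξ : ℝ → ℝ) s • φ y) s x⟫ +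
      ⟪V x, convect V ((fun s y => (ξ : ℝ → ℝ) s • φ y) s) x⟫ +
      1 * ⟪V x, Δ ((fun s y => (ξ : ℝ → ℝ) s • φ y) s) x⟫) =
      deriv (ξ : ℝ → ℝ) s * ⟪V x, φ x⟫ + (ξ : ℝ → ℝ) s * (⟪V x, convect V φ x⟫ + ⟪V x, Δ φ x⟫) := by
    intro s x
    have h1 : timeDeriv (fun s y => (ξ : ℝ → ℝ) s • φ y) s x = deriv (ξ : ℝ → ℝ) s • φ x :=
      timeDeriv_prod_smul hξd φ s x
    have h2 : convect V (fun y => (ξ : ℝ → ℝ) s • φ y) x = (ξ : ℝ → ℝ) s • convect V φ x := by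
      rw [convect_apply, convect_apply,
        fderiv_fun_const_smul ((hφ.contDiff.differentiable (by simp)) x) ((ξ : ℝ → ℝ) s),
        FunLike.coe_smul, Pi.smul_apply]
    have h3 : Δ (fun y => (ξ : ℝ → ℝ) s • φ y) x = (ξ : ℝ → ℝ) s • Δ φ x :=
      laplacian_const_smul hφ2 _ x
    simp only [h1, h2, h3, real_inner_smul_right, one_mul]
    ring
  have hslice : ∀ s, (∫ x, (⟪V x, timeDeriv (fun s y => (ξ : ℝ → ℝ) s • φ y) s x⟫ +
      ⟪V x, convect V ((fun s y => (ξ : ℝ → ℝ) s • φ y) s) x⟫ +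
      1 * ⟪V x, Δ ((fun s y => (ξ : ℝ → ℝ) s • φ y) s) x⟫)) =
      deriv (ξ : ℝ → ℝ) s * A + (ξ : ℝ → ℝ) s * B := by
    intro s
    rw [integral_congr_ae (Eventually.of_forall (hpt s))]
    rw [integral_add (hIA.const_mul _) (hIB.const_mul _), integral_const_mul, integral_const_mul]
  rw [setIntegral_congr_fun measurableSet_Ioo (fun s _ => hslice s)] at key
  -- the time integrals
  have hderiv0 : ∀ s, s ∉ Ioo (-1 : ℝ) 0 → deriv (ξ : ℝ → ℝ) s = 0 := by
    intro s hs
    have h0 : (ξ : ℝ → ℝ) =ᶠ[𝓝 s] fun _ => 0 :=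
      notMem_tsupport_iff_eventuallyEq.1 fun h => hs (hξsupp h)
    rw [h0.deriv_eq, deriv_const]
  have hξ0 : ∀ s, s ∉ Ioo (-1 : ℝ) 0 → (ξ : ℝ → ℝ) s = 0 := fun s hs =>
    image_eq_zero_of_notMem_tsupport fun h => hs (hξsupp h)
  have hdc : Continuous (deriv (ξ : ℝ → ℝ)) := (ξ.contDiff (n := ⊤)).continuous_deriv (by simp)
  have hI1 : IntegrableOn (fun s => deriv (ξ : ℝ → ℝ) s * A) (Ioo (-1 : ℝ) 0) volume :=
    ((hdc.mul continuous_const).integrableOn_Icc (a := -1) (b := 0)).mono_set Ioo_subset_Icc_self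
  have hI2 : IntegrableOn (fun s => (ξ : ℝ → ℝ) s * B) (Ioo (-1 : ℝ) 0) volume :=
    ((ξ.continuous.mul continuous_const).integrableOn_Icc (a := -1) (b := 0)).mono_set
      Ioo_subset_Icc_self
  have hint1 : ∫ s in Ioo (-1 : ℝ) 0, deriv (ξ : ℝ → ℝ) s * A = 0 := by
    rw [integral_mul_const, setIntegral_eq_integral_of_forall_compl_eq_zero hderiv0]
    rw [integral_eq_zero_of_hasDerivAt_of_integrable (fun s => (hξd s).hasDerivAt)
      (hdc.integrable_of_hasCompactSupport ξ.hasCompactSupport.deriv) ξ.integrable, zero_mul]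
  have hint2 : ∫ s in Ioo (-1 : ℝ) 0, (ξ : ℝ → ℝ) s * B = (∫ s, (ξ : ℝ → ℝ) s) * B := by
    rw [integral_mul_const, setIntegral_eq_integral_of_forall_compl_eq_zero hξ0]
  have hξpos : 0 < ∫ s, (ξ : ℝ → ℝ) s := ξ.integral_pos
  rw [integral_add hI1 hI2, hint1, hint2, zero_add] at key
  exact (mul_eq_zero.1 key).resolve_left hξpos.ne'

end Steady

/-! ### Chae 2010, Thm. 1.4: the weak limit, and the theorem for `3 < p ≤ 9/2` -/

section Chae

variable {T γ : ℝ} {p : ℝ≥0}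
  {v : ℝ → EuclideanSpace ℝ (Fin 3) → EuclideanSpace ℝ (Fin 3)}
  {π : ℝ → EuclideanSpace ℝ (Fin 3) → ℝ}
  {V : EuclideanSpace ℝ (Fin 3) → EuclideanSpace ℝ (Fin 3)}

/-- **Chae 2010, proof of Thm. 1.4 — the weak limit: the Type-II blow-up profile is a very weak
STEADY Navier–Stokes solution.** Let `T > 0`, `(v, π)` a classical solution of Navier–Stokes
(`ν = 1`, no force) on `ℝ³ × (0, T)`, `γ > 1`, `p ∈ [2, ∞)`, and `V̄ ∈ L^p(ℝ³)` with
`chaeTypeIIDeviation T γ p v V̄ t → 0` as `t ↑ T` (the displayed hypothesis of Thm. 1.4: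
`(T−t)^{(p−3)γ/(2p)}‖v(·,t) − (T−t)^{−γ/2}V̄(·/(T−t)^{γ/2})‖_{L^p} → 0`). Then `V̄` is weakly
divergence free and, for every divergence-free `φ ∈ C_c^∞(ℝ³; ℝ³)`,
`∫ (⟪V̄, (V̄·∇)φ⟫ + ⟪V̄, Δφ⟫) dy = 0` — the divergence-free tested, pressure-free form of "`V̄` is
a stationary solution of the Navier–Stokes equations, namely there exists `P̄` such that
`(V̄·∇)V̄ = ΔV̄ − ∇P̄`, `div V̄ = 0`" (exactly the pair of hypotheses of
`SteadyNSVeryWeakLpLiouville.lean`). Kato-class continuity `v ∈ C([0,T); L^p)` is not needed for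
this step. [cite: Chae2010, Thm. 1.4 proof (= arXiv:0711.1113 §3, proof of Thm. 3.1, display (3.1a))] -/
theorem typeII_profile_veryWeak_steadyNS (hT : 0 < T)
    (hv : IsClassicalNSSolutionOn (Ioo 0 T) 1 0 v π) (hγ : 1 < γ) (hp2 : 2 ≤ p)
    (hV : MemLp V (p : ℝ≥0∞) volume)
    (hconv : Tendsto (chaeTypeIIDeviation T γ p v V) (𝓝[<] T) (𝓝 0)) :
    IsWeaklyDivFree V ∧
      ∀ φ : EuclideanSpace ℝ (Fin 3) → EuclideanSpace ℝ (Fin 3),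
        FunctionSpaces.IsTestFunctionOn (⊤ : Opens (EuclideanSpace ℝ (Fin 3))) φ →
        VectorCalculus.IsDivFree φ → ∫ x, (⟪V x, convect V φ x⟫ + ⟪V x, Δ φ x⟫) = 0 :=
  ⟨typeII_profile_isWeaklyDivFree hT hv hγ (le_trans one_le_two hp2) hV hconv,
    fun _ hφ hdivφ => steady_veryWeak_of_const_slab hp2 hV
      (fun _ hψ hdivψ =>
        typeII_profile_integral_veryWeak_const_eq_zero hT hv hγ hp2 hV hconv hψ hdivψ) hφ hdivφ⟩

/-- **The Type-II profile is a.e. a smooth steady Navier–Stokes velocity** (`3 < p < ∞`): under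
the hypotheses of `typeII_profile_veryWeak_steadyNS` with `p > 3` there is a steady classical
solution `(U, P̄)` of Navier–Stokes on `ℝ³` (`IsSteadyClassicalNS 1 0 U P̄`: smooth,
`(U·∇)U = ΔU − ∇P̄`, `div U = 0`) with `V̄ = U` a.e. — Chae's "there exists `P̄` such that
`(V̄·∇)V̄ = ΔV̄ − ∇P̄`, `div V̄ = 0`" at the classical level (the tree's
`exists_steadyClassicalNS_ae_eq_of_veryWeak`, Kato's representative).
[cite: Chae2010, Thm. 1.4 proof (arXiv:0711.1113 §3, display (3.1a)); Kato1984, Thm. 1] -/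
theorem typeII_profile_ae_eq_steadyClassicalNS (hT : 0 < T)
    (hv : IsClassicalNSSolutionOn (Ioo 0 T) 1 0 v π) (hγ : 1 < γ) (hp3 : 3 < p)
    (hV : MemLp V (p : ℝ≥0∞) volume)
    (hconv : Tendsto (chaeTypeIIDeviation T γ p v V) (𝓝[<] T) (𝓝 0)) :
    ∃ (U : EuclideanSpace ℝ (Fin 3) → EuclideanSpace ℝ (Fin 3)) (P : EuclideanSpace ℝ (Fin 3) → ℝ),
      IsSteadyClassicalNS 1 0 U P ∧ V =ᵐ[volume] U := by
  obtain ⟨hdiv, hsteady⟩ :=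
    typeII_profile_veryWeak_steadyNS hT hv hγ (le_trans (by norm_num) hp3.le) hV hconv
  exact exists_steadyClassicalNS_ae_eq_of_veryWeak hp3 hV hdiv hsteady

/-- **Chae 2010, Theorem 1.4, in the range `3 < p ≤ 9/2` — a theorem.** The statement of the
named fact `chae2010_typeII_asymptoticallySelfSimilar` (J. Funct. Anal. 258 (2010), Thm. 1.4 =
arXiv:0711.1113, Thm. 3.1: a Kato-class classical solution on `(0, T)`, `γ > 1`, an `L^p` profile
`V̄` with `(T−t)^{(p−3)γ/(2p)}‖v(·,t) − (T−t)^{−γ/2}V̄(·/(T−t)^{γ/2})‖_{L^p} → 0`, `V̄ ∈ Ḣ¹` ⇒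
`V̄ = 0`), verbatim its binders, with the two extra hypotheses `3 < p` and `p ≤ 9/2`: then `V̄ = 0`
a.e. Proof = the printed one: `V̄` is a very weak steady solution
(`typeII_profile_veryWeak_steadyNS`), hence by `veryWeak_steadyNS_ae_eq_zero_of_weakGradL2Sq_lt_top`
(Kato representative + Galdi's `L^{9/2}` Liouville criterion via `Ḣ¹ ∩ L^p ⊂ L^{9/2}`) it
vanishes. For `p > 9/2` the last step is the open `SteadyDSolutionLiouvilleProblem`; `p = 3` is not
covered; the fact itself is not discharged. [cite: Chae2010, Thm. 1.4 (= arXiv:0711.1113 Thm. 3.1); Galdi2011, Thm. X.9.5] -/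
theorem chae2010_typeII_asymptoticallySelfSimilar_of_le_nineHalves
    ⦃T : ℝ⦄ (hT : 0 < T) ⦃p : ℝ≥0⦄ (hp3 : 3 < p) (hp92 : (p : ℝ≥0∞) ≤ 9 / 2)
    ⦃v : ℝ → EuclideanSpace ℝ (Fin 3) → EuclideanSpace ℝ (Fin 3)⦄
    ⦃π : ℝ → EuclideanSpace ℝ (Fin 3) → ℝ⦄
    (hv : IsClassicalNSSolutionOn (Ioo 0 T) 1 0 v π) (_hvc : ContinuousInLpOn (Ico 0 T) p v)
    ⦃γ : ℝ⦄ (hγ : 1 < γ) ⦃V : EuclideanSpace ℝ (Fin 3) → EuclideanSpace ℝ (Fin 3)⦄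
    (hV : MemLp V (p : ℝ≥0∞) volume)
    (hconv : Tendsto (chaeTypeIIDeviation T γ p v V) (𝓝[<] T) (𝓝 0))
    (hH1 : eWeakGradL2Sq V < ⊤) :
    V =ᵐ[volume] 0 := by
  obtain ⟨hdiv, hsteady⟩ :=
    typeII_profile_veryWeak_steadyNS hT hv hγ (le_trans (by norm_num) hp3.le) hV hconv
  exact veryWeak_steadyNS_ae_eq_zero_of_weakGradL2Sq_lt_top hp3 hp92 hV hdiv hsteady hH1

end Chae

end Literature.Analysis.FluidPDE

end
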